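import Literature.MathematicalPhysics.QuantumFieldTheory.Balaban1983to89.Node00.BackgroundActionOfRecord

/-!
# `Balaban1983to89.B11SectGPerturbedComposition` — T. Bałaban, *The variational problem and background fields in renormalization group method for lattice gauge
# theories*, Commun. Math. Phys. **102** (1985) 277–309 [Balaban1985Variational], **Sect. G pp. 305–309** («Analyticity and an Expansion of U_k»): (172)–(175), (181),
# **Proposition 9** p. 309 — the LOCALISATION OF THE PERTURBED MINIMISER `U_k(V′V₀) = U₁·U_k(V₀)`, `U₁ = exp iη𝓗(B′)`, `𝓗` of size `ε₂ = B₅ε₁` — as ONE NAMED FACT in NODE 00's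
# vocabulary (`Node00.Uk`, `UkExists`, `UniqueUkOrbit`, `bgReg`), orbit-level and plaquette-class (GAP-STATED below); used at [Balaban1987RG1] p. 265 («As in Sect. G [15] we write
# U_k(V′V^{(k)}) = U′_k(V′)U_{k+1}») to keep the fluctuation integral on the MEMBERSHIP domain `U_k(V) ∈ 𝔘_k(ε₀)`

statement-level skeleton of published theorems with citation tags; proofs where landed; nothing here is a claim about the Yang–Mills mass gap

Cell `pub-ymgap` (YM-PLAN Track A), seat `pub-ymgap-dag-n09-w1` g8 — director-ym №320 (4) OPTION (L): «TYPE [B11] Sect. G ∕ Prop. 9 as the INHABITANT of `hmemχ`∕`hopen`» (the displayed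
rows of NODE N09's door v1.3, `Summits/…/BalabanUVNodesN09MembershipDomainDoor(AtRecord)` ✓, `…N09MembershipSupportClauseReading` ✓).  ONE file for the print section (D-0064).
PDF held: `paper:balaban1985-cmp102-variational-background` (journal page = PDF page + 276); pp. 305–309 [PDF 29–33] read by this seat from the `lit read` text layer (2026-08-29).

CITATION HEADER.  WHAT IS REPRODUCED, verbatim where the OCR allows: p. 305 [PDF 29]: «The minimal configuration U_k is a (multi-valued) function of the average variables V,
U_k = U_k(V). We will show that it is an analytic function of V in the following sense: if V = V′V₀, V′ small, U₀ = U_k(V₀), and if we fix a gauge condition for U_k(V′V₀)U₀⁻¹, then it is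
an analytic function of B = 1∕i log V′ …»; (172) «Now let us take V = V′V₀, V₀ satisfies the condition (7), V′ satisfies |V′ − 1| < C₁ε₁, hence V′ = e^{iB′}, |B′| < 2C₁ε₁ on 𝔅_k, for ε₁
sufficiently small. We take U₀ = U_k(V₀) and we consider the pair of configurations U_k(V′V₀), U₀. We repeat the whole procedure of Sects. A–E for this pair. At first we fix the Landau
gauge for the configuration U_k(V′V₀)U₀⁻¹ = U₁, and we have U₁ = exp iη𝓗(B′), 𝓗 satisfies the conditions (19)–(21) with ε₂ = … = B₅ε₁. (173) We assume that C₁ is an absolute constant,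
hence B₅ is such a constant also.»; p. 307 [PDF 31] (181) «For the minimal configurations in the axial gauge we have U_k(V^v) = U_k(V)^{ṽ}, where ṽ is constant on blocks B(y), y ∈ 𝔅_k,
and equal to v(y)»; **Proposition 9** p. 309 [PDF 33]: «The minimal configuration U_k(V) = U_k(V′V₀) in the axial gauge has an extension to an analytic function of G^c-valued small
configurations V′ on 𝔅_k. It can be extended further to all orbits of such configurations V′V₀ by the equality (181). The function U_k(V′V₀)U_k(V₀)⁻¹ transformed to the Landau gauge is,
by the definition, equal to exp iη𝓗(B), where B = 1∕i log V′. The function 𝓗(B) is determined by Eqs. (174), (175), or (179), (180). It is an analytic function of B, and also of the external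
gauge field configuration U … It satisfies the conditions (19)–(21) with ε₂ = B₅ε₁ (see (173)), and its functional derivative (182) satisfies the inequalities (190).»

WHAT IS TYPED (this file = the named factS ONLY — §1 the (173) print image `SectGLocalisedMinimiser`, §2 (appended 2026-08-29, cell (L1c)) its WINDOW-PROPORTIONAL form `SectGLipschitzMinimiser`
(one more letter `δ` = size of the fluctuation; increment `κ·B₆·δ`; GAP-STATED (γ5) Schwarz step) — statement-only lane; the bookkeeping — monotonicity, the `L⁻²` room `bgReg K (k+1) ρ = bgReg K k (ρ∕L²)`, the specialisation
to [I] p. 265's use, the room's inhabitation — lands Summits-side in NODE N09's `…N09SectGCompositionBookkeeping`).  §1 ONE NAMED FACT `SectGLocalisedMinimiser F N B₃ B₅ C₁ a₀ a₁` (a `def … : Prop`, asserted by NOBODY; consumers take `(hG : SectGLocalisedMinimiser …)` and stay CONDITIONAL):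
for a level-`k` datum `V₀` satisfying (7) with `0 < ε₁ ≤ a₁`, a radius `ε₀ ∈ [B₃ε₁, a₀]` (Thm 1's window, p. 279) at which the (0.21) problem at `V₀` is solvable with unique minimal residual
orbit and whose minimiser OF RECORD `Uk … ε₀ V₀` lies in the plaquette class `bgReg K k r₀` (its own regularity radius `r₀`), and a fluctuation `V′` with `dist1 (V′ b) < C₁ε₁` at every bond
((172)): IF the problem at the bondwise product `V′·V₀` is solvable with unique minimal orbit at `ε₀` (Thm 1 at `V = V′V₀` — a HYPOTHESIS here, N07's slot, not Sect. G's content), THEN its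
minimiser of record lies in `bgReg K k (r₀ + κ·B₅ε₁)` — (173)∕Prop. 9's «(19)–(21) with ε₂ = B₅ε₁» (`B₅ = 6B₁B₃C₁`, tree `B11Carve16SectGHyp.constB5_def` ∕ `B11.ineq173` ∕ `B11.Prop9Printed`) for `U₁ = U_k(V′V₀)U₀⁻¹` read on plaquettes with the EXPLICIT conversion letter `κ`: `|∂(U₁U₀)(p) − 1| ≤ |∂U₀(p) − 1| + κ·B₅ε₁·η_k²`.
GAP-STATED (displayed deviations from print, never smuggled): (γ1) print states the localisation for the Landau-gauge representative `U₁` relative to the specific representative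
`U₀ = U_k(V₀)` with the (19)–(21) NORMS (sup of `𝓗`, `∇^η𝓗`, `Δ^η𝓗`); the named fact keeps only the PLAQUETTE consequence at the ORBIT level (NODE 00's `Uk` is a bare choice in the minimal
orbit; plaquette classes are orbit- and gauge-invariant), with the norms-to-plaquettes factor an EXPLICIT letter `κ` (node00-def RR-2 WORD-23 AMEND-2); (γ2) print's minimisers live in the (2)-classes `𝔘_k({Ω_j}, ·)` with the current
condition — NODE 00's `bgReg` is the plaquette class only (node00-def-B divergence D-defB-1), so «solvable with unique minimal orbit» is read in NODE 00's `UkExists`∕`UniqueUkOrbit` sense;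
(γ3) «V₀ satisfies (7)» is `PlaqSmall ε₁ V₀` on the whole level-`k` torus (one-region case `Ω_k` = everything, as everywhere in NODE 00); (γ4) the analyticity clause of Prop. 9 itself is the
tree's `B11Claim309UAnalytic` (chart level) and is NOT restated here.
HONEST FRAMING: a named fact + bookkeeping; NOTHING of Bałaban's asserted as a theorem; no estimate proved; counts unmoved; K-texts untouched; FLAG №7′ of the cell stays OPEN (this is the
print image of its residue row `hmemχ`'s membership conjunct, not a discharge); one finite `T⁴` per run; NOT continuum ∕ ℝ⁴ ∕ OS ∕ mass-gap ∕ Clay.  No `sorry`, no `instance`, no `notation`.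
-/

noncomputable section

namespace Literature.MathematicalPhysics.QuantumFieldTheory.Balaban1983to89.B11SectGPerturbedComposition

open Node00 T4Continuum

variable (F : T4Family) (N : ℕ) [NeZero N]

/-! ## §1. The named fact: localisation of the perturbed minimiser ((172)–(173), Prop. 9) -/

/-- **[B11] SECT. G LOCALISATION OF THE PERTURBED MINIMISER — NAMED FACT** (orbit-level, plaquette-class reading; GAP-STATED (γ1)–(γ3) in the module docstring).  For every torus `K`,
level `k`, letters `ε₁, ε₀, r₀` and level-`k` data `V₀`, `V′`: if `0 < ε₁ ≤ a₁`, `B₃ε₁ ≤ ε₀ ≤ a₀` (Thm 1's window), `V₀` satisfies (7) (`PlaqSmall ε₁ V₀`), the (0.21) problem at `V₀` is solvable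
at radius `ε₀` with unique minimal orbit and minimiser of record in `bgReg K k r₀`, the fluctuation satisfies `dist1 (V′ b) < C₁ε₁` at every bond ((172)), and the problem at the bondwise
product `V′·V₀` is solvable at `ε₀` with unique minimal orbit (Thm 1 at `V′V₀`), then the minimiser of record of `V′·V₀` lies in `bgReg K k (r₀ + κ·B₅·ε₁)` — print: `U_k(V′V₀) = U₁U₀`,
`U₁ = exp iη𝓗(B′)` with `𝓗` in (19)–(21) at `ε₂ = B₅ε₁` ((173); Prop. 9), where `B₅ = 6B₁B₃C₁` (print (173): «ε₂ = B₁(B₃(1 + 4C₁)ε₁ + C₁ε₁) ≤ 6B₁B₃C₁ε₁ = B₅ε₁»; tree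
`B11Carve16SectGHyp.constB5_def`, `B11.ineq173`, statement `B11.Prop9Printed`) — independent of `k` and `ε₁` but CARRYING `B₃`; kept a free parameter here (weaker fact; consumers instantiate
`B₅ := constB5 B₁ B₃ C₁` or larger) — and `κ` is the EXPLICIT letter converting the (19)–(21) norms of `𝓗` (sup of `𝓗`, `∇^η𝓗`) into the plaquette deviation of `U₁U₀` relative to `U₀`
(`|∂(U₁U₀)(p) − 1| ≤ |∂U₀(p) − 1| + κ·ε₂·η_k²`, a `d`-dependent absolute constant; GAP-STATED (γ1)).  Print's hierarchy p. 278: «if the space (6) is non-empty and ε₀ is sufficiently small,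
then by Proposition 2 [4] the configuration V satisfies (7) with ε₁ = O(ε₀). Hence our assumption has a meaning only for ε₁ smaller than ε₀.»  A `Prop`; INHABITED BY: nobody (named fact;
print [B11] (172)–(174) + Prop. 9).
[cite: Balaban1985Variational, Sect. G (172)–(173) p.305 and Prop. 9 p.309] -/
def SectGLocalisedMinimiser (B₃ B₅ C₁ a₀ a₁ κ : ℝ) : Prop :=
  ∀ (K k : ℕ) (ε₁ ε₀ r₀ : ℝ) (V₀ V' : GaugeField (F.P K) k (SU N)),
    0 < ε₁ → ε₁ ≤ a₁ → B₃ * ε₁ ≤ ε₀ → ε₀ ≤ a₀ → PlaqSmall ε₁ V₀ →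
    UkExists F N K k ε₀ V₀ → UniqueUkOrbit F N K k ε₀ V₀ → Uk F N K k ε₀ V₀ ∈ bgReg F N K k r₀ →
    (∀ b : PBond (F.P K) k, dist1 (V' b) < C₁ * ε₁) →
    UkExists F N K k ε₀ (fun b => V' b * V₀ b) → UniqueUkOrbit F N K k ε₀ (fun b => V' b * V₀ b) →
      Uk F N K k ε₀ (fun b => V' b * V₀ b) ∈ bgReg F N K k (r₀ + κ * B₅ * ε₁)

/-! ## §2. The WINDOW-PROPORTIONAL (Lipschitz ∕ Schwarz) form of the localisation — [I] p. 265 «H_k(B′) … of the same order as B′» over Prop. 9's analyticity (cell (L1c)) -/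

/-- **[B11] SECT. G LOCALISATION OF THE PERTURBED MINIMISER, WINDOW-PROPORTIONAL FORM — NAMED FACT** (cell `pub-ymgap` (L1c): the shape dag-ref-H READ-604 (iii) ∕ ym-nodeO DEF-1 ∕
node00-def-RR-2 WORD-26 asked for, 2026-08-29).  The SAME data and window as `SectGLocalisedMinimiser` (§1) plus ONE more letter `δ` — the SIZE OF THE FLUCTUATION, kept separate from the
(7)-letter `ε₁` of the base point `V₀`: if moreover `0 ≤ δ ≤ C₁ε₁` and `dist1 (V′ b) < δ` at every bond (so (172)'s `|V′ − 1| < C₁ε₁` holds), then the minimiser of record of the bondwise product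
`V′·V₀` lies in `bgReg K k (r₀ + κ·B₆·δ)` — an increment PROPORTIONAL TO THE WINDOW `δ`, whose constant `B₆` may carry `B₁, B₃` but NOT the base letter `ε₁`.  PRINT: [Balaban1987RG1] p. 265
«We obtain U′_k u_k⁻¹ = exp iηH_k(B′), where the 𝔤-valued configuration H_k(B′) is regular and of the same order as B′. Its properties are described in Sect. G [15].»; [B11] (174) p. 305
«𝓗 = H₁B + 𝓗₁, where 𝓗₁ satisfies (175) and the regularity conditions (19) with ε₂ = B₅ε₁», p. 306 «This implies that the expansion of 𝓗 begins with the first order term H₁B», p. 306–307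
«Independently of the representation chosen, the function 𝓗(B) is an analytic function of G^c-valued configurations B defined on 𝔅_k and satisfying (172)», Prop. 9 p. 309 «It is an
analytic function of B … It satisfies the conditions (19)–(21) with ε₂ = B₅ε₁ (see (173))».  GAP-STATED, in addition to §1's (γ1)–(γ3) (orbit-level PLAQUETTE reading with the explicit
conversion letter `κ`; NODE 00's plaquette classes; one-region case), (γ5): the Lipschitz inequality `‖𝓗(B)‖₍₁₉₎ ≤ (B₅ε₁)·|B|∕(2C₁ε₁)` on the whole (172)-ball `|B| < 2C₁ε₁` is the one-line
SCHWARZ-LEMMA consequence of Prop. 9 (analytic on that complex sup-ball, bounded there by `ε₂ = B₅ε₁` in the (19)-norms, vanishing at `B = 0` since `U_k(1·V₀) = U₀`; one-variable Schwarz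
along `ζ ↦ 𝓗(ζB∕|B|)`), whence with `|B′| < 2δ` for `|V′ − 1| < δ` (p. 305's own factor 2) the increment constant `B₆ ≤ B₅∕C₁ = 6B₁B₃` — NOT a numbered display of [B11]: it is exactly what the letter `B₆` names (kept FREE; consumers instantiate), and [I] p. 265 prints it qualitatively («of the same
order as B′»).  WHY THIS FORM (cell record, READ-604): §1's increment `κB₅ε₁` is keyed to the COMMON letter `ε₁ ≥ plaq(V₀)`; at `V₀ = V^{(k)}(W) = M^k(U_{k+1}(W))` over a `ρ`-member
(`plaq(V^{(k)}) ≈ 2ρ∕L²`, [Balaban1985Averaging] Prop. 2) it fits the `L⁻²` room `bgReg K (k+1) ρ = bgReg K k (ρ∕L²)` only if `1 + 2κB₅ ≤ L²`, empty at `B₅ = 6B₁B₃C₁`, `B₃ ≳ L²`; the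
window-proportional increment fits whenever `δ ≤ ρ(1 − L⁻²)∕(κB₆)` — an UPPER bound on the (2.9) window only ([I] p. 266 «ε₁ sufficiently small»).  §1 stays as the print image of (173) (not wrong;
not the inhabitant).  A `Prop`; INHABITED BY: nobody (named fact).
[cite: Balaban1987RG1, p.265 and (2.9) p.266; Balaban1985Variational, (172)–(174) p.305, p.306 and Prop. 9 p.309] -/
def SectGLipschitzMinimiser (B₃ B₆ C₁ a₀ a₁ κ : ℝ) : Prop :=
  ∀ (K k : ℕ) (ε₁ ε₀ r₀ δ : ℝ) (V₀ V' : GaugeField (F.P K) k (SU N)),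
    0 < ε₁ → ε₁ ≤ a₁ → B₃ * ε₁ ≤ ε₀ → ε₀ ≤ a₀ → PlaqSmall ε₁ V₀ →
    UkExists F N K k ε₀ V₀ → UniqueUkOrbit F N K k ε₀ V₀ → Uk F N K k ε₀ V₀ ∈ bgReg F N K k r₀ →
    0 ≤ δ → δ ≤ C₁ * ε₁ → (∀ b : PBond (F.P K) k, dist1 (V' b) < δ) →
    UkExists F N K k ε₀ (fun b => V' b * V₀ b) → UniqueUkOrbit F N K k ε₀ (fun b => V' b * V₀ b) →
      Uk F N K k ε₀ (fun b => V' b * V₀ b) ∈ bgReg F N K k (r₀ + κ * B₆ * δ)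

end Literature.MathematicalPhysics.QuantumFieldTheory.Balaban1983to89.B11SectGPerturbedComposition

end
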